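import Summits.MatrixMultiplication.MatrixMultiplication.Theorems.SoloInformedCwTwoLevelInduction
import Summits.MatrixMultiplication.MatrixMultiplication.Theorems.SoloInformedCwTwoRigidReduction

/-!
# CONJECTURE L reduces to RIGID systems (solo-informed, gen 13; CLAIMS c164)

The fully symmetric form of `levelConjecture_of_rigidStep`: using pair reindexing, CONJECTURE L for all mixed
designs follows from CONJECTURE L for the RIGID ones (`IsRigid`: no pair can be demoted to two singletons leaving
a mixed design), `levelConjecture_of_fullyRigidStep`.

Standard axioms only.
-/

namespace Summit.MatrixMultiplication.MatrixMultiplication.Theorems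

open Finset

/-- The number of `U`'s is invariant under reindexing the pairs. -/
theorem uCount_reindex {p : ℕ} (o : Fin p → Bool) (σ : Equiv.Perm (Fin p)) :
    uCount (fun k => o (σ k)) = uCount o := by
  simp only [uCount, Finset.card_filter]
  exact Equiv.sum_comp σ (fun j => if o j = true then 1 else 0)

/-- Transport of a working orientation back along a reindexing. -/
theorem orientedHallSix_of_reindex {p q : ℕ} (s d : Fin p → ℕ) (t : Fin q → ℕ) (σ : Equiv.Perm (Fin p))
    (o : Fin p → Bool) (h : OrientedHallSix (fun k => s (σ k)) (fun k => d (σ k)) t o) :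
    OrientedHallSix s d t (fun k => o (σ.symm k)) := by
  have h' := orientedHallSix_reindex (fun k => s (σ k)) (fun k => d (σ k)) t o σ.symm h
  simpa using h'

/-- The residual hypothesis: CONJECTURE L for RIGID mixed designs. -/
def LevelFullyRigidStep : Prop :=
  ∀ {p q : ℕ} (s d : Fin (p + 1) → ℕ) (t : Fin q → ℕ), IsMixedDesign s d t → IsRigid s d t →
    ∀ j, 0 < j → j < p + 1 → ∃ o : Fin (p + 1) → Bool, uCount o = j ∧ OrientedHallSix s d t o

/-- **Reduction of CONJECTURE L to rigid systems.** -/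
theorem levelConjecture_of_fullyRigidStep (hstep : LevelFullyRigidStep) : LevelConjecture := by
  intro p
  induction p with
  | zero =>
    intro q s d t hD j hj hjp
    omega
  | succ p ih =>
    intro q s d t hD j hj hjp
    by_cases hrig : IsRigid s d t
    · exact hstep s d t hD hrig j hj hjp
    · simp only [IsRigid, not_forall, not_not] at hrig
      obtain ⟨σ, hdem⟩ := hrig
      -- work in the reindexed system `S_σ = (s ∘ σ, d ∘ σ ; t)`, whose last-pair demotion is a design
      have main : ∃ o : Fin (p + 1) → Bool, uCount o = j ∧
          OrientedHallSix (fun k => s (σ k)) (fun k => d (σ k)) t o := by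
        rcases Nat.lt_or_ge j p with hlt | hge
        · obtain ⟨o', hc, hw⟩ := ih _ _ _ hdem j hj hlt
          refine ⟨Fin.snoc (α := fun _ => Bool) o' false, ?_,
            orientedHallSix_of_demote (fun k => s (σ k)) (fun k => d (σ k)) t o' false hw⟩
          rw [uCount_snoc, hc]
          simp
        · have hjp' : j = p := by omega
          subst hjp'
          rcases Nat.lt_or_ge 1 j with h1 | h1
          · obtain ⟨o', hc, hw⟩ := ih _ _ _ hdem (j - 1) (by omega) (by omega)
            refine ⟨Fin.snoc (α := fun _ => Bool) o' true, ?_,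
              orientedHallSix_of_demote (fun k => s (σ k)) (fun k => d (σ k)) t o' true hw⟩
            rw [uCount_snoc, hc]
            simp
            omega
          · obtain rfl : j = 1 := by omega
            have hw := onePair_orientedHallSix_T _ _ _ hdem
            refine ⟨Fin.snoc (α := fun _ => Bool) (fun _ : Fin 1 => false) true, ?_,
              orientedHallSix_of_demote (fun k => s (σ k)) (fun k => d (σ k)) t _ true hw⟩
            rw [uCount_snoc]
            simp [uCount]
      obtain ⟨o, hc, hw⟩ := main
      refine ⟨fun k => o (σ.symm k), ?_, orientedHallSix_of_reindex s d t σ o hw⟩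
      rw [uCount_reindex o σ.symm, hc]

end Summit.MatrixMultiplication.MatrixMultiplication.Theorems
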